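import Literature.Probability.RandomPlanarGeometry.HexSAWStripBridgeLengthPointwise
import Literature.Probability.RandomPlanarGeometry.HexSAWStripThresholdLinearLower
import HarnessLib

/-!
# At the strip threshold the partition functions grow EXACTLY exponentially: `x_c^n Z_{T,n}(y_T) ≍ 1` and the β-walks of each
# length are bounded — no polynomial correction (the strip's "γ = 1"), for every width `T ≥ 2`

Topic `Literature/Probability/RandomPlanarGeometry` (continues `HexSAWStripBridgeLengthPointwise.lean` — the horizontal bridges of each
exact length have bounded weight at `y_T` —, `HexSAWStripBridgeDecomposition.lean` / `HexSAWStripBridgeRenewal.lean` (the curtain decomposition of a `β`-walk: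
`HV.decTriple`, `HV.wt_eq_tripleWt_decTriple`, `HV.decTriple_injOn`, `HV.length_pieces`, `HV.exists_topFreeSumN_le`, `HV.exists_botFreeSumN_le`,
the mirror for case B) and `HexSAWStripThresholdLinearLower.lean` (the direct split of a chain: `HV.LinLow.dSplit`, `cwt_eq_dWt`,
`dSplit_injOn`, `exists_botAvoidSum_le`, `exists_sum_pow_length_le`, the time reversal `revStd`)).  Sources: N. R. Beaton et al., CMP 326
(2014), arXiv:1109.0358v5, §3.2 Proposition 6 (p. 10: `μ_T(y,z) = lim c_{T,k}(y,z)^{1/k}`) and Corollary 8 (p. 12: `ρ_T(y_T) = x_c`);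
N. Madras, G. Slade, *The Self-Avoiding Walk* (1993) §8.2 (walks in a tube, sub-multiplicativity (8.2.2)–(8.2.3)); Duminil-Copin–Smirnov
(2012) §3; Duminil-Copin–Hammond (2013) §2.2.  In print: the existence of the growth rate (Fekete) and `ρ_T(y_T) = x_c`; the ORDER of
`Z_{T,n}(y_T)` relative to `x_c^{−n}` is not printed — in the tree only Fekete's floor `x_c^n Z_{T,n}(y_T) ≥ 1/max(1,y_T⁻¹)`.

## What is proved (namespace `Literature.Probability.RandomPlanarGeometry.SAW.HV`; plumbing in `HV.ChainPW`; `x_c = hexCriticalFugacity`)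

* `ChainPW.sum_sliced_le` — the sliced triple-product bound (an injective decomposition whose middle piece lies in a slice determined
  by the outer pieces, each slice bounded by `K`, sums to at most `(Σ outer₁) · K · (Σ outer₂)`).
* `betaLen T L n` — the `β`-walk lists of `S_{T,L}` with exactly `n` vertices; `sum_caseB_len_le` (mirror);
  ★★ `exists_betaLen_stripYT_le` (`T ≥ 2`) — `∃ C, ∀ L n, Σ_{betaLen T L n} x_c^{|l|} y_T^{#top(l)} ≤ C`.
* ★★★ `exists_pow_mul_stripZL_stripYT_le` (`T ≥ 2`) — `∃ C, ∀ n, x_c^n Z_{T,n}(y_T) ≤ C`;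
  ★★★ `exists_pow_mul_stripZL_stripYT_two_sided` — `∃ c C, 0 < c ∧ ∀ n, c ≤ x_c^n Z_{T,n}(y_T) ≤ C`.
* ★★ `stripGFy_beta_stripYT_le_card` (`T ≥ 2`) — `B_{T,L}(x_c; y_T) ≤ K (|V(S_{T,L})| + 1)`: a second route to the linear upper law.

Why it matters (lane «pcv-sawmu», a-p2 g17): AT the critical surface fugacity of the width-`T` strip the `n`-step partition function is
`≍ ν_T(y_T)^n = x_c^{−n}` with a BOUNDED prefactor — the threshold is a purely one-dimensional critical point (exponent `γ = 1`), in
contrast with `y < y_T` (`x_c^n Z_{T,n}(y) → 0` geometrically, tree) and `y > y_T` (`→ ∞`); together with the pointwise threshold law for the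
contact count and the span/length laws this completes the pointwise picture of the renewal structure at `y_T`.  NOT claimed: convergence
of `x_c^n Z_{T,n}(y_T)`, `T = 1` (explicit in the tree), uniformity in `T`.
-/

noncomputable section

open Finset Filter Topology Literature.Probability.LatticeModels Literature.Probability.Percolation

namespace Literature.Probability.RandomPlanarGeometry.SAW.HV

namespace ChainPW

variable {T L : ℕ}

/-! ### §1 A sliced product bound (plumbing) -/

/-- `Σ_{s ∪ t} f ≤ Σ_s f + Σ_t f` for `f ≥ 0` (plumbing). [cite: BeatonBousquetMelouDeGierDuminilCopinGuttmann2014, §3.2 (sums of non-negative weights); lane plumbing] (`private` — statement-twin of `HV.hvSum_union_le_add / HV.hvSum_biUnion_le_sum_sum` in `HexSAWStripThresholdPointwise.lean`, which this file does not import.) -/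
private theorem sum_union_le {α : Type*} [DecidableEq α] (s t : Finset α) (f : α → ℝ) (hf : ∀ x, 0 ≤ f x) :
    ∑ x ∈ s ∪ t, f x ≤ ∑ x ∈ s, f x + ∑ x ∈ t, f x := by
  rw [← Finset.sum_union_inter]
  have : 0 ≤ ∑ x ∈ s ∩ t, f x := sum_nonneg fun x _ => hf x
  linarith

/-- `Σ_{⋃_i t_i} f ≤ Σ_i Σ_{t_i} f` for `f ≥ 0` (plumbing). [cite: BeatonBousquetMelouDeGierDuminilCopinGuttmann2014, §3.2 (sums of non-negative weights); lane plumbing] (`private` — statement-twin of `HV.hvSum_union_le_add / HV.hvSum_biUnion_le_sum_sum` in `HexSAWStripThresholdPointwise.lean`, which this file does not import.) -/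
private theorem sum_biUnion_le {ι α : Type*} [DecidableEq α] (s : Finset ι) (t : ι → Finset α) (f : α → ℝ)
    (hf : ∀ x, 0 ≤ f x) : ∑ x ∈ s.biUnion t, f x ≤ ∑ i ∈ s, ∑ x ∈ t i, f x := by
  classical
  induction s using Finset.induction_on with
  | empty => simp
  | insert a s ha ih =>
    rw [Finset.biUnion_insert, Finset.sum_insert ha]
    exact (sum_union_le _ _ f hf).trans (add_le_add le_rfl ih)

/-- ★ **Sliced triple products**: if `φ` maps `S` injectively into triples `(a, b, c) ∈ A × B × C` with `b` lying in the slice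
`B_{m(a,c)}` determined by the two outer pieces, and every slice sum `Σ_{B_m} w₂ ≤ K`, then
`Σ_{s ∈ S} w₁(φ s).1 · w₂(φ s).2.1 · w₃(φ s).2.2 ≤ (Σ_A w₁) · K · (Σ_C w₃)` (all weights `≥ 0`).
[cite: DuminilCopinHammond2013, §2.2 (decompositions with multiplicative weights); lane plumbing] (`private` — generic finset bookkeeping, lane notice #5.) -/
private theorem sum_sliced_le {σ α β γ : Type*} [DecidableEq α] [DecidableEq β] [DecidableEq γ] (S : Finset σ) (A : Finset α) (C : Finset γ)
    (Bm : α → γ → Finset β) (φ : σ → α × β × γ) (hφ : Set.InjOn φ S)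
    (hmem : ∀ s ∈ S, (φ s).1 ∈ A ∧ (φ s).2.2 ∈ C ∧ (φ s).2.1 ∈ Bm (φ s).1 (φ s).2.2)
    (w₁ : α → ℝ) (w₂ : β → ℝ) (w₃ : γ → ℝ) (h₁ : ∀ a, 0 ≤ w₁ a) (h₂ : ∀ b, 0 ≤ w₂ b) (h₃ : ∀ c, 0 ≤ w₃ c)
    {K : ℝ} (hK : ∀ a ∈ A, ∀ c ∈ C, ∑ b ∈ Bm a c, w₂ b ≤ K) :
    ∑ s ∈ S, w₁ (φ s).1 * w₂ (φ s).2.1 * w₃ (φ s).2.2 ≤ (∑ a ∈ A, w₁ a) * K * ∑ c ∈ C, w₃ c := by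
  classical
  set f : α × β × γ → ℝ := fun t => w₁ t.1 * w₂ t.2.1 * w₃ t.2.2 with hf
  have hf0 : ∀ t, 0 ≤ f t := fun t => mul_nonneg (mul_nonneg (h₁ _) (h₂ _)) (h₃ _)
  set tgt : Finset (α × β × γ) := A.biUnion (fun a => C.biUnion (fun c => ({a} : Finset α) ×ˢ (Bm a c ×ˢ ({c} : Finset γ)))) with htgt
  have himg : ∀ s ∈ S, φ s ∈ tgt := by
    intro s hs
    obtain ⟨ha, hc, hb⟩ := hmem s hs
    rw [htgt, mem_biUnion]
    refine ⟨(φ s).1, ha, ?_⟩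
    rw [mem_biUnion]
    refine ⟨(φ s).2.2, hc, ?_⟩
    rw [mem_product, mem_product]
    exact ⟨mem_singleton_self _, hb, mem_singleton_self _⟩
  have hKnonneg : ∀ a ∈ A, ∀ c ∈ C, 0 ≤ K := fun a ha c hc => le_trans (sum_nonneg fun b _ => h₂ b) (hK a ha c hc)
  calc ∑ s ∈ S, w₁ (φ s).1 * w₂ (φ s).2.1 * w₃ (φ s).2.2 = ∑ s ∈ S, f (φ s) := rfl
    _ ≤ ∑ t ∈ tgt, f t := sum_le_sum_of_injOn_of_nonneg φ hφ himg f fun t _ => hf0 t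
    _ ≤ ∑ a ∈ A, ∑ t ∈ C.biUnion (fun c => ({a} : Finset α) ×ˢ (Bm a c ×ˢ ({c} : Finset γ))), f t := sum_biUnion_le _ _ f hf0
    _ ≤ ∑ a ∈ A, ∑ c ∈ C, ∑ t ∈ ({a} : Finset α) ×ˢ (Bm a c ×ˢ ({c} : Finset γ)), f t :=
        sum_le_sum fun a _ => sum_biUnion_le _ _ f hf0
    _ = ∑ a ∈ A, ∑ c ∈ C, w₁ a * (∑ b ∈ Bm a c, w₂ b) * w₃ c := by
        refine sum_congr rfl fun a _ => sum_congr rfl fun c _ => ?_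
        rw [sum_product, sum_singleton, sum_product]
        simp only [hf, sum_singleton]
        rw [mul_sum, sum_mul]
    _ ≤ ∑ a ∈ A, ∑ c ∈ C, w₁ a * K * w₃ c :=
        sum_le_sum fun a ha => sum_le_sum fun c hc =>
          mul_le_mul_of_nonneg_right (mul_le_mul_of_nonneg_left (hK a ha c hc) (h₁ a)) (h₃ c)
    _ = (∑ a ∈ A, w₁ a) * K * ∑ c ∈ C, w₃ c := by rw [sum_mul, sum_mul]; refine sum_congr rfl fun a _ => ?_; rw [mul_sum]

end ChainPW

/-! ### §2 ★★ β-walks of exact length are bounded at the threshold -/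

section Beta

variable {T L : ℕ}

/-- The `β`-walk lists of `S_{T,L}` (inner lists of the walks `a → β`) with exactly `n` vertices (plumbing). [cite: DuminilCopinSmirnov2012, §3 (walks a → β of S_{T,L}); lane] -/
def betaLen (T L n : ℕ) : Finset (List HV) := (bridgeLists T L).filter fun l => l.length = n

/-- Case B of length `n` weighs at most case A of length `n` (the mirror keeps lengths and weights). [cite: DuminilCopinSmirnov2012, §3 (Fig. 3: symmetry of S_{T,L}); lane plumbing] -/
theorem sum_caseB_len_le (hT : 1 ≤ T) {y : ℝ} (hy : 0 ≤ y) (n : ℕ) :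
    ∑ l ∈ (caseB T L).filter (fun l => l.length = n), hexCriticalFugacity ^ l.length * y ^ topCnt T l ≤
      ∑ l ∈ (caseA T L).filter (fun l => l.length = n), hexCriticalFugacity ^ l.length * y ^ topCnt T l := by
  classical
  have hinj : Set.InjOn (fun l : List HV => l.map mirrorX) ((caseB T L).filter (fun l => l.length = n) : Set (List HV)) :=
    fun l _ l' _ h => (List.map_injective_iff.2 mirrorX.injective) h
  calc ∑ l ∈ (caseB T L).filter (fun l => l.length = n), hexCriticalFugacity ^ l.length * y ^ topCnt T l
      = ∑ l ∈ (caseB T L).filter (fun l => l.length = n),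
          hexCriticalFugacity ^ (l.map mirrorX).length * y ^ topCnt T (l.map mirrorX) :=
        sum_congr rfl fun l _ => by rw [List.length_map, topCnt_map_mirrorX]
    _ ≤ ∑ l ∈ (caseA T L).filter (fun l => l.length = n), hexCriticalFugacity ^ l.length * y ^ topCnt T l := by
        refine sum_le_sum_of_injOn_of_nonneg (fun l : List HV => l.map mirrorX) hinj (fun l hl => ?_)
          (fun l : List HV => hexCriticalFugacity ^ l.length * y ^ topCnt T l)
          fun l _ => mul_nonneg (pow_nonneg hexCriticalFugacity_pos_lt_one.1.le _) (pow_nonneg hy _)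
        rw [mem_filter, caseB, mem_filter] at hl
        rw [mem_filter, caseA, mem_filter, sIdx_map_mirrorX, tIdx_map_mirrorX, List.length_map]
        exact ⟨⟨map_mirrorX_mem_bridgeLists hT hl.1.1, hl.1.2⟩, hl.2⟩

set_option maxHeartbeats 400000 in
/-- ★★ **The `β`-walks of `S_{T,L}` with exactly `n` vertices have bounded weight at `y_T`, uniformly in `L` and `n`** (`T ≥ 2`):
the curtain decomposition of `HexSAWStripBridgeDecomposition` / `HexSAWStripBridgeRenewal` (top-free head ⊕ horizontal bridge ⊕ bottom-free tail) sliced by the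
length of the middle piece, with the length-pointwise law of `HexSAWStripBridgeLengthPointwise`.
[cite: DuminilCopinSmirnov2012, §3; DuminilCopinHammond2013, §2.2; BeatonBousquetMelouDeGierDuminilCopinGuttmann2014, Corollary 8 (y_T); lane «pcv-sawmu»: NEW] -/
theorem exists_betaLen_stripYT_le (hT : 2 ≤ T) :
    ∃ C : ℝ, ∀ L n : ℕ, ∑ l ∈ betaLen T L n, hexCriticalFugacity ^ l.length * stripYT T ^ topCnt T l ≤ C := by
  classical
  have hT1 : 1 ≤ T := by omega
  have hx := hexCriticalFugacity_pos_lt_one.1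
  have hy := (stripYT_pos hT1).le
  obtain ⟨C₁, hC₁⟩ := exists_topFreeSumN_le hT1
  obtain ⟨C₃, hC₃⟩ := exists_botFreeSumN_le hT (one_le_stripYT hT1) (hexCriticalFugacity_mul_stripNu_pred_stripYT_lt_one hT)
  obtain ⟨K, hK⟩ := exists_hBridgesN_length_stripYT_le hT1
  have hK0 : 0 ≤ K := le_trans (sum_nonneg fun _ _ => mul_nonneg (pow_nonneg hx.le _) (pow_nonneg hy _)) (hK 0 0)
  have hC₁0 : 0 ≤ C₁ := le_trans (sum_nonneg fun _ _ => pow_nonneg hx.le _) (hC₁ 0)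
  refine ⟨2 * (C₁ * K * C₃), fun L n => ?_⟩
  set y := stripYT T with hydef
  set N := (stripV T L).card with hN
  set w : List HV → ℝ := fun l => hexCriticalFugacity ^ l.length * y ^ topCnt T l with hw
  have hw0 : ∀ l, 0 ≤ w l := fun l => mul_nonneg (pow_nonneg hx.le _) (pow_nonneg hy _)
  set w₁ : List HV → ℝ := fun q => hexCriticalFugacity ^ (q.length - 1) with hw₁
  set w₂ : List HV → ℝ := fun h => hexCriticalFugacity ^ h.length * y ^ topCnt T h with hw₂
  set w₃ : List HV → ℝ := fun r => hexCriticalFugacity ^ (r.length - 1) * y ^ topCnt T r.tail with hw₃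
  set Bm : List HV → List HV → Finset (List HV) := fun q r =>
    (hBridgesN T N).filter (fun h => 2 ≤ h.length ∧ hlen h = ((n : ℤ) + 1 - q.length - r.length)) with hBm
  set SA := (caseA T L).filter (fun l => l.length = n) with hSA
  -- unpacking case A
  have hmem : ∀ l ∈ SA, l.IsChain hvGraph.Adj ∧ l.head? = some hvOrigin ∧ l.Nodup ∧
      (∀ v ∈ l, v ∈ stripV T L) ∧ (∃ h : l ≠ [], lev (l.getLast h) = 2 * T - 1) ∧ sIdx l < tIdx l ∧ l.length ≤ N + 1 ∧ l.length = n := by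
    intro l hl
    rw [hSA, mem_filter, caseA, mem_filter] at hl
    obtain ⟨⟨hb, hst⟩, hn⟩ := hl
    obtain ⟨hc, hh, hnd, hV, hne, hlev⟩ := (mem_bridgeLists_iff hT1).1 hb
    exact ⟨hc, hh, hnd, hV, ⟨hne, hlev⟩, hst, (length_le_card_stripV hT1 hb).trans (by omega), hn⟩
  have hterm : ∀ l ∈ SA, w l = w₁ (decTriple l).1 * w₂ (decTriple l).2.1 * w₃ (decTriple l).2.2 := by
    intro l hl
    obtain ⟨hc, hh, hnd, hV, -, hst, -, -⟩ := hmem l hl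
    have h := wt_eq_tripleWt_decTriple hc hnd hV hh hst y
    rw [tripleWt] at h
    simpa only [hw, hw₁, hw₂, hw₃] using h
  have hinjA : Set.InjOn decTriple (SA : Set (List HV)) := by
    refine decTriple_injOn.mono fun l hl => ?_
    obtain ⟨-, hh, -, -, -, hst, -, -⟩ := hmem l hl
    exact ⟨by rintro rfl; simp at hh, hst⟩
  have hmemA : ∀ l ∈ SA, (decTriple l).1 ∈ topFreeN T N ∧ (decTriple l).2.2 ∈ botFreeN T N ∧
      (decTriple l).2.1 ∈ Bm (decTriple l).1 (decTriple l).2.2 := by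
    intro l hl
    obtain ⟨hc, hh, hnd, hV, ⟨hne, hlev⟩, hst, hNl, hn⟩ := hmem l hl
    have hl0 : l ≠ [] := by rintro rfl; simp at hh
    obtain ⟨hl1, hl2, hl3⟩ := length_pieces hl0 hst
    obtain ⟨hs1, -, ht1l, -, -⟩ := t1Idx_spec hl0 hst
    refine ⟨headP_mem_topFreeN hc hnd hV hh hst hNl, xstd_tailP_mem_botFreeN hc hnd hV hlev hst hNl, ?_⟩
    show xstd (midP l) ∈ Bm (headP l) (xstd (tailP l))
    rw [hBm]; dsimp only
    rw [mem_filter]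
    refine ⟨xstd_midP_mem_hBridgesN hc hnd hV hh hst hNl, by rw [length_xstd]; omega, ?_⟩
    rw [hlen, length_xstd, length_xstd, hl1, hl2, hl3, ← hn]
    push_cast [Nat.cast_sub (show sIdx l ≤ t1Idx l + 1 by omega), Nat.cast_sub (show t1Idx l ≤ l.length by omega)]
    ring
  have hKslice : ∀ q ∈ topFreeN T N, ∀ r ∈ botFreeN T N, ∑ h ∈ Bm q r, w₂ h ≤ K := fun q _ r _ => hK N _
  have hslice := ChainPW.sum_sliced_le SA (topFreeN T N) (botFreeN T N) Bm decTriple hinjA hmemA w₁ w₂ w₃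
    (fun _ => pow_nonneg hx.le _) (fun _ => mul_nonneg (pow_nonneg hx.le _) (pow_nonneg hy _))
    (fun _ => mul_nonneg (pow_nonneg hx.le _) (pow_nonneg hy _)) hKslice
  have hA : ∑ l ∈ SA, w l ≤ C₁ * K * C₃ := by
    have e1 : ∑ l ∈ SA, w l = ∑ l ∈ SA, w₁ (decTriple l).1 * w₂ (decTriple l).2.1 * w₃ (decTriple l).2.2 := sum_congr rfl hterm
    have e2 : (∑ q ∈ topFreeN T N, w₁ q) = topFreeSumN T N := rfl
    have e3 : (∑ r ∈ botFreeN T N, w₃ r) = botFreeSumN T N y := rfl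
    rw [e1]
    refine hslice.trans ?_
    rw [e2, e3]
    have h1 := hC₁ N
    have h3 := hC₃ N
    have h30 : 0 ≤ botFreeSumN T N y := (botFreeSumN_nonneg_mono T N hy le_rfl).1
    calc topFreeSumN T N * K * botFreeSumN T N y ≤ C₁ * K * botFreeSumN T N y :=
          mul_le_mul_of_nonneg_right (mul_le_mul_of_nonneg_right h1 hK0) h30
      _ ≤ C₁ * K * C₃ := mul_le_mul_of_nonneg_left h3 (mul_nonneg hC₁0 hK0)
  -- both cases
  have hB := sum_caseB_len_le (L := L) hT1 hy n
  have hsplit : betaLen T L n ⊆ SA ∪ (caseB T L).filter (fun l => l.length = n) := by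
    intro l hl
    rw [betaLen, mem_filter, bridgeLists_eq_caseA_union_caseB hT1, mem_union] at hl
    obtain ⟨hab, hn⟩ := hl
    rw [mem_union, hSA, mem_filter, mem_filter]
    rcases hab with h | h
    · exact Or.inl ⟨h, hn⟩
    · exact Or.inr ⟨h, hn⟩
  calc ∑ l ∈ betaLen T L n, w l ≤ ∑ l ∈ SA ∪ (caseB T L).filter (fun l => l.length = n), w l :=
        sum_le_sum_of_subset_of_nonneg hsplit fun l _ _ => hw0 l
    _ ≤ ∑ l ∈ SA, w l + ∑ l ∈ (caseB T L).filter (fun l => l.length = n), w l := ChainPW.sum_union_le _ _ w hw0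
    _ ≤ C₁ * K * C₃ + C₁ * K * C₃ := add_le_add hA (hB.trans hA)
    _ = 2 * (C₁ * K * C₃) := by ring

end Beta

/-! ### §3 ★★★ Chains of exact length are bounded at the threshold: `x_c^n Z_{T,n}(y_T) ≤ C` -/

section Chains

variable {T : ℕ}

open LinLow

/-- Lengths of the three pieces of the direct split. [cite: MadrasSlade1993, §8.2 (8.2.2) (splitting a walk); lane plumbing] -/
theorem length_dSplit {N : ℕ} {l : List HV} (hl : l ∈ caseDSet T N) :
    (dA l).length = jB l + 1 ∧ (dM T l).length = iT T l + 1 - jB l ∧ (dC T l).length = l.length - iT T l ∧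
      jB l < iT T l ∧ iT T l < l.length := by
  obtain ⟨n, -, -, -, -, hlen, -, -, hD⟩ := of_mem_caseDSet hl
  obtain ⟨hj, hi, hji, -⟩ := caseD_spec hD
  refine ⟨?_, ?_, ?_, hji, hi⟩
  · rw [dA, List.length_take]; omega
  · rw [dM, length_xstd, List.length_drop, List.length_take]; omega
  · rw [dC, length_xstd, List.length_drop]

/-- `β`-walk lists of `S_{T,L}` of a prescribed (integer) length weigh at most the length-slice bound. [cite: DuminilCopinSmirnov2012, §3; lane plumbing] -/
theorem sum_bridgeLists_lengthZ_le {L : ℕ} {y : ℝ} (hy : 0 ≤ y) {K : ℝ}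
    (hK : ∀ m, ∑ l ∈ betaLen T L m, hexCriticalFugacity ^ l.length * y ^ topCnt T l ≤ K) (z : ℤ) :
    ∑ l ∈ (bridgeLists T L).filter (fun l => (l.length : ℤ) = z), hexCriticalFugacity ^ l.length * y ^ topCnt T l ≤ K := by
  refine le_trans (sum_le_sum_of_subset_of_nonneg (fun l hl => ?_) fun l _ _ =>
    mul_nonneg (pow_nonneg hexCriticalFugacity_pos_lt_one.1.le _) (pow_nonneg hy _)) (hK z.toNat)
  rw [mem_filter] at hl
  rw [betaLen, mem_filter]
  exact ⟨hl.1, by rw [← hl.2]; simp⟩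

set_option maxHeartbeats 400000 in
/-- ★★★ **`x_c^n Z_{T,n}(y_T) ≤ C_T` for every `n`** (`T ≥ 2`): the partition function of the `n`-step chains of the strip at its critical
surface fugacity grows EXACTLY like `x_c^{−n} = ν_T(y_T)^n`, with a bounded prefactor — no polynomial correction (the strip's "γ = 1").
Route: the direct split of `HexSAWStripThresholdLinearLower` (bottom-avoiding prefix ⊕ ONE β-walk ⊕ top-free suffix) sliced by the
length of the middle piece, the β-walks of exact length being bounded by §2; chains without top vertices weigh `x_c^n`, chains without
bottom vertices are bottom-avoiding, and the case «all tops before all bottoms» is a time reversal.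
[cite: BeatonBousquetMelouDeGierDuminilCopinGuttmann2014, Proposition 6 and Corollary 8 (arXiv v5 pp. 10–13: ν_T(y) = lim Z_{T,n}(y)^{1/n}, ρ_T(y_T) = x_c); MadrasSlade1993, §8.2; lane «pcv-sawmu»: NEW] -/
theorem exists_pow_mul_stripZL_stripYT_le (hT : 2 ≤ T) :
    ∃ C : ℝ, ∀ n : ℕ, hexCriticalFugacity ^ n * stripZL T n (stripYT T) ≤ C := by
  classical
  have hT1 : 1 ≤ T := by omega
  have hx := hexCriticalFugacity_pos_lt_one.1
  have hy1 := one_le_stripYT hT1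
  have hy : 0 ≤ stripYT T := by linarith
  obtain ⟨S, hS0, hS⟩ := exists_sum_pow_length_le hT1
  have hlt : stripYT T < stripYT (T - 1) := by
    have h := stripYT_succ_lt (T := T - 1) (by omega)
    rwa [Nat.sub_add_cancel hT1] at h
  obtain ⟨CB, hCB⟩ := exists_botAvoidSum_le hT hy1 hlt
  have hCB0 : 0 ≤ CB := (botAvoidSum_nonneg T 0 hy).trans (hCB 0)
  obtain ⟨Kβ, hKβ⟩ := exists_betaLen_stripYT_le hT
  have hKβ0 : 0 ≤ Kβ := le_trans (sum_nonneg fun _ _ => mul_nonneg (pow_nonneg hx.le _) (pow_nonneg hy _)) (hKβ 0 0)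
  refine ⟨S + CB + 2 * (CB * (hexCriticalFugacity⁻¹ * Kβ) * S), fun n => ?_⟩
  set y := stripYT T with hydef
  set U := stripChains T n with hU
  -- the chain partition function as a sum of `cwt`
  have hZ : hexCriticalFugacity ^ n * stripZL T n y = ∑ l ∈ U, cwt T y l := by
    rw [stripZL, mul_sum]
    refine sum_congr rfl fun l hl => ?_
    rw [cwt, (mem_stripChains_iff.1 hl).2.2.1, Nat.add_sub_cancel]
  have hUsub : U ⊆ chainsUpTo T n := fun l hl => mem_chainsUpTo_of_mem hl le_rfl
  -- the four parts
  set U₀ := U.filter (fun l => ¬ (topIdxs T l).Nonempty) with hU₀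
  set U₁ := U.filter (fun l => (topIdxs T l).Nonempty ∧ ¬ (botIdxs l).Nonempty) with hU₁
  set UD := U.filter (fun l => CaseD T l) with hUD
  set UR := U.filter (fun l => (topIdxs T l).Nonempty ∧ (botIdxs l).Nonempty ∧ ¬ CaseD T l) with hUR
  have hcover : ∀ l ∈ U, l ∈ U₀ ∨ l ∈ U₁ ∨ l ∈ UD ∨ l ∈ UR := by
    intro l hl
    by_cases h0 : (topIdxs T l).Nonempty
    · by_cases h1 : (botIdxs l).Nonempty
      · by_cases hD : CaseD T l
        · exact Or.inr (Or.inr (Or.inl (mem_filter.2 ⟨hl, hD⟩)))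
        · exact Or.inr (Or.inr (Or.inr (mem_filter.2 ⟨hl, h0, h1, hD⟩)))
      · exact Or.inr (Or.inl (mem_filter.2 ⟨hl, h0, h1⟩))
    · exact Or.inl (mem_filter.2 ⟨hl, h0⟩)
  have hcwt0 : ∀ l, 0 ≤ cwt T y l := fun l => cwt_nonneg T hy l
  have hle4 : ∑ l ∈ U, cwt T y l ≤ ∑ l ∈ U₀, cwt T y l + ∑ l ∈ U₁, cwt T y l + ∑ l ∈ UD, cwt T y l + ∑ l ∈ UR, cwt T y l := by
    have hsub : U ⊆ U₀ ∪ U₁ ∪ UD ∪ UR := fun l hl => by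
      rcases hcover l hl with h | h | h | h <;> simp [mem_union, h]
    calc ∑ l ∈ U, cwt T y l ≤ ∑ l ∈ U₀ ∪ U₁ ∪ UD ∪ UR, cwt T y l := sum_le_sum_of_subset_of_nonneg hsub fun l _ _ => hcwt0 l
      _ ≤ ∑ l ∈ U₀ ∪ U₁ ∪ UD, cwt T y l + ∑ l ∈ UR, cwt T y l := ChainPW.sum_union_le _ _ _ hcwt0
      _ ≤ (∑ l ∈ U₀ ∪ U₁, cwt T y l + ∑ l ∈ UD, cwt T y l) + ∑ l ∈ UR, cwt T y l :=
          add_le_add (ChainPW.sum_union_le _ _ _ hcwt0) le_rfl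
      _ ≤ (∑ l ∈ U₀, cwt T y l + ∑ l ∈ U₁, cwt T y l + ∑ l ∈ UD, cwt T y l) + ∑ l ∈ UR, cwt T y l :=
          add_le_add (add_le_add (ChainPW.sum_union_le _ _ _ hcwt0) le_rfl) le_rfl
  -- (0) no top vertex: weight x_c^n
  have h0 : ∑ l ∈ U₀, cwt T y l ≤ S := by
    calc ∑ l ∈ U₀, cwt T y l = ∑ l ∈ U₀, hexCriticalFugacity ^ (l.length - 1) :=
          sum_congr rfl fun l hl => by rw [cwt, topCnt_eq_zero_of_not_nonempty (mem_filter.1 hl).2, pow_zero, mul_one]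
      _ ≤ ∑ l ∈ chainsUpTo T n, hexCriticalFugacity ^ (l.length - 1) :=
          sum_le_sum_of_subset_of_nonneg (fun l hl => hUsub (mem_filter.1 hl).1) fun l _ _ => pow_nonneg hx.le _
      _ ≤ S := hS n
  -- (1) top but no bottom: bottom-avoiding
  have h1 : ∑ l ∈ U₁, cwt T y l ≤ CB := by
    calc ∑ l ∈ U₁, cwt T y l ≤ botAvoidSum T n y :=
          sum_le_sum_of_subset_of_nonneg (fun l hl => mem_botAvoidN_of_not_nonempty (hUsub (mem_filter.1 hl).1) (mem_filter.1 hl).2.2)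
            fun l _ _ => hcwt0 l
      _ ≤ CB := hCB n
  -- (D) the direct case, sliced by the length of the middle β-walk
  have hD : ∑ l ∈ UD, cwt T y l ≤ CB * (hexCriticalFugacity⁻¹ * Kβ) * S := by
    have hUDsub : ∀ l ∈ UD, l ∈ caseDSet T n := fun l hl =>
      mem_filter.2 ⟨hUsub (mem_filter.1 hl).1, (mem_filter.1 hl).2⟩
    set w₁ : List HV → ℝ := fun A => cwt T y A with hw₁
    set w₂ : List HV → ℝ := fun M => hexCriticalFugacity⁻¹ * (hexCriticalFugacity ^ M.length * y ^ topCnt T M) with hw₂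
    set w₃ : List HV → ℝ := fun C => hexCriticalFugacity ^ (C.length - 1) with hw₃
    set Bm : List HV → List HV → Finset (List HV) := fun A C =>
      (bridgeLists T n).filter (fun M => (M.length : ℤ) = (n : ℤ) + 3 - A.length - C.length) with hBm
    have hterm : ∀ l ∈ UD, cwt T y l = w₁ (dSplit T l).1 * w₂ (dSplit T l).2.1 * w₃ (dSplit T l).2.2 := by
      intro l hl
      rw [cwt_eq_dWt (hUDsub l hl), dWt, hw₁, hw₂, hw₃]
      simp only [dSplit]
      ring
    have hinj : Set.InjOn (dSplit T) (UD : Set (List HV)) :=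
      (dSplit_injOn T n).mono fun l hl => hUDsub l hl
    have hmemD : ∀ l ∈ UD, (dSplit T l).1 ∈ botAvoidN T n ∧ (dSplit T l).2.2 ∈ chainsUpTo T n ∧
        (dSplit T l).2.1 ∈ Bm (dSplit T l).1 (dSplit T l).2.2 := by
      intro l hl
      have hl' := hUDsub l hl
      have hm := dSplit_mem hT1 hl'
      rw [mem_product, mem_product] at hm
      obtain ⟨hA, hM, hC⟩ := hm
      obtain ⟨h1, h2, h3, hji, hil⟩ := length_dSplit hl'
      have hlen : l.length = n + 1 := (mem_stripChains_iff.1 (mem_filter.1 hl).1).2.2.1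
      refine ⟨hA, hC, ?_⟩
      show dM T l ∈ Bm (dA l) (dC T l)
      rw [hBm]; dsimp only
      rw [mem_filter]
      refine ⟨hM, ?_⟩
      rw [h1, h2, h3, hlen]
      push_cast [Nat.cast_sub (show jB l ≤ iT T l + 1 by omega), Nat.cast_sub (show iT T l ≤ n + 1 by omega)]
      ring
    have hKslice : ∀ A ∈ botAvoidN T n, ∀ C ∈ chainsUpTo T n, ∑ M ∈ Bm A C, w₂ M ≤ hexCriticalFugacity⁻¹ * Kβ := by
      intro A _ C _
      rw [hw₂, ← mul_sum]
      exact mul_le_mul_of_nonneg_left (sum_bridgeLists_lengthZ_le hy (hKβ n) _) (inv_nonneg.2 hx.le)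
    have hslice := ChainPW.sum_sliced_le UD (botAvoidN T n) (chainsUpTo T n) Bm (dSplit T) hinj hmemD w₁ w₂ w₃
      (fun _ => cwt_nonneg T hy _) (fun _ => mul_nonneg (inv_nonneg.2 hx.le) (mul_nonneg (pow_nonneg hx.le _) (pow_nonneg hy _)))
      (fun _ => pow_nonneg hx.le _) hKslice
    calc ∑ l ∈ UD, cwt T y l = ∑ l ∈ UD, w₁ (dSplit T l).1 * w₂ (dSplit T l).2.1 * w₃ (dSplit T l).2.2 := sum_congr rfl hterm
      _ ≤ (∑ A ∈ botAvoidN T n, w₁ A) * (hexCriticalFugacity⁻¹ * Kβ) * ∑ C ∈ chainsUpTo T n, w₃ C := hslice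
      _ = botAvoidSum T n y * (hexCriticalFugacity⁻¹ * Kβ) * ∑ C ∈ chainsUpTo T n, hexCriticalFugacity ^ (C.length - 1) := by
          rw [botAvoidSum]
      _ ≤ CB * (hexCriticalFugacity⁻¹ * Kβ) * S := by
          have hSn := hS n
          have hBn := hCB n
          have hB0 := botAvoidSum_nonneg T n hy
          have hS0' : 0 ≤ ∑ C ∈ chainsUpTo T n, hexCriticalFugacity ^ (C.length - 1) := sum_nonneg fun _ _ => pow_nonneg hx.le _
          have hk0 : 0 ≤ hexCriticalFugacity⁻¹ * Kβ := mul_nonneg (inv_nonneg.2 hx.le) hKβ0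
          exact mul_le_mul (mul_le_mul_of_nonneg_right hBn hk0) hSn hS0' (mul_nonneg hCB0 hk0)
  -- (R) the reversed case maps into the direct case
  have hR : ∑ l ∈ UR, cwt T y l ≤ ∑ l ∈ UD, cwt T y l := by
    have hinjR : Set.InjOn revStd (UR : Set (List HV)) :=
      (revStd_injOn T n).mono fun l hl => hUsub (mem_filter.1 hl).1
    calc ∑ l ∈ UR, cwt T y l = ∑ l ∈ UR, cwt T y (revStd l) := sum_congr rfl fun l _ => (cwt_revStd T y l).symm
      _ ≤ ∑ l ∈ UD, cwt T y l := by
          refine sum_le_sum_of_injOn_of_nonneg revStd hinjR (fun l hl => ?_) _ fun l _ => hcwt0 l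
          rw [hUR, mem_filter] at hl
          obtain ⟨hlU, htop, hbot, hnD⟩ := hl
          exact mem_filter.2 ⟨revStd_mem hlU, caseD_revStd htop hbot hnD⟩
  rw [hZ]
  have hD0 : 0 ≤ CB * (hexCriticalFugacity⁻¹ * Kβ) * S := by positivity
  linarith [hle4, h0, h1, hD, hR]

/-- ★★★ **Two-sided: `x_c^n Z_{T,n}(y_T) ≍ 1`** (`T ≥ 2`): `∃ c C, 0 < c ∧ ∀ n, c ≤ x_c^n Z_{T,n}(y_T) ≤ C` — Fekete's floor
`ν_T(y_T)^n ≤ max(1, y_T⁻¹) Z_{T,n}(y_T)` with `ν_T(y_T) = x_c⁻¹` below, the split bound above.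
[cite: BeatonBousquetMelouDeGierDuminilCopinGuttmann2014, Proposition 6 and Corollary 8 (arXiv v5 pp. 10–13); lane «pcv-sawmu»: NEW (the order of Z_{T,n} at the threshold is exactly exponential)] -/
theorem exists_pow_mul_stripZL_stripYT_two_sided (hT : 2 ≤ T) :
    ∃ c C : ℝ, 0 < c ∧ ∀ n : ℕ, c ≤ hexCriticalFugacity ^ n * stripZL T n (stripYT T) ∧
      hexCriticalFugacity ^ n * stripZL T n (stripYT T) ≤ C := by
  have hT1 : 1 ≤ T := by omega
  have hx := hexCriticalFugacity_pos_lt_one.1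
  have hy := stripYT_pos hT1
  obtain ⟨C, hC⟩ := exists_pow_mul_stripZL_stripYT_le hT
  have hYK : 0 < HexBW.yK (stripYT T) := lt_of_lt_of_le one_pos (HexBW.one_le_yK _)
  refine ⟨(HexBW.yK (stripYT T))⁻¹, C, inv_pos.2 hYK, fun n => ⟨?_, hC n⟩⟩
  have h := pow_stripNu_le hT1 n hy (stripNu_pos hT1 hy).le
  rw [stripNu_stripYT hT1, inv_pow] at h
  -- h : (x_c^n)⁻¹ ≤ yK · Z_n
  have hxn : 0 < hexCriticalFugacity ^ n := pow_pos hx n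
  rw [inv_le_iff_one_le_mul₀ hYK]
  calc 1 = hexCriticalFugacity ^ n * (hexCriticalFugacity ^ n)⁻¹ := by rw [mul_inv_cancel₀ hxn.ne']
    _ ≤ hexCriticalFugacity ^ n * (HexBW.yK (stripYT T) * stripZL T n (stripYT T)) := mul_le_mul_of_nonneg_left h hxn.le
    _ = hexCriticalFugacity ^ n * stripZL T n (stripYT T) * HexBW.yK (stripYT T) := by ring

/-- ★★ **A second route to the linear UPPER law in the boxes**: `B_{T,L}(x_c; y_T) ≤ K_β · (|V(S_{T,L})| + 1)` (`T ≥ 2`), hence `O(L)` —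
every `β`-walk of `S_{T,L}` has at most `|V(S_{T,L})|` vertices and each length slice weighs at most `K_β`.
[cite: BeatonBousquetMelouDeGierDuminilCopinGuttmann2014, Corollary 8 (arXiv v5 p. 12); DuminilCopinSmirnov2012, §3; lane «pcv-sawmu»] -/
theorem stripGFy_beta_stripYT_le_card (hT : 2 ≤ T) :
    ∃ K : ℝ, ∀ L : ℕ, stripGFy T L (IsBetaDart T) (stripYT T) ≤ K * ((stripV T L).card + 1) := by
  classical
  have hT1 : 1 ≤ T := by omega
  have hx := hexCriticalFugacity_pos_lt_one.1
  have hy := (stripYT_pos hT1).le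
  obtain ⟨K, hK⟩ := exists_betaLen_stripYT_le hT
  refine ⟨K, fun L => ?_⟩
  rw [stripGFy_beta_eq_sum_bridgeLists hT1]
  have hfib : ∀ l ∈ bridgeLists T L, l.length ∈ range ((stripV T L).card + 1) := fun l hl =>
    mem_range.2 (Nat.lt_succ_of_le (length_le_card_stripV hT1 hl))
  rw [← sum_fiberwise_of_maps_to hfib]
  calc ∑ m ∈ range ((stripV T L).card + 1), ∑ l ∈ (bridgeLists T L).filter (fun l => l.length = m),
        hexCriticalFugacity ^ l.length * stripYT T ^ (l.filter fun v => lev v = 2 * (T : ℤ) - 1).length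
      ≤ ∑ m ∈ range ((stripV T L).card + 1), K := sum_le_sum fun m _ => hK L m
    _ = K * ((stripV T L).card + 1) := by rw [sum_const, card_range, nsmul_eq_mul]; push_cast; ring

end Chains

end Literature.Probability.RandomPlanarGeometry.SAW.HV
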